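import Literature.NumberTheory.Automorphic.Liu2021.Thm418AsPrinted
import Literature.LinearAlgebra.BaseChange.FixedPointsBaseChange
import HarnessLib

/-!
# Liu 2021, Thm. 4.18: `K`-fixed vectors after the base change `M_μ → ℂ` — the module-algebra step
# `(Ω(μ) ⊗_{M_μ} ℂ)^K = Ω(μ)^K ⊗_{M_μ} ℂ` on the AS-PRINTED record, and its transport through the printed isomorphism

[Liu2021] = Yifeng Liu, *Fourier–Jacobi cycles and arithmetic relative trace formula*, Camb. J. Math. **9** (2021)
1–147 = arXiv:2102.11518 (TeX source `FJcycle.tex`, md5 `6db49a74122d2cb0f224fa1b39488a0c`; `l. NNNN` = its lines).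

## What this file is (and for whom)

Support for the Hodge-CM bridge «[Liu2021] Thm. 4.18 AS PRINTED ⟹ the combined reading `Thm418C`» (pub-hodgecm2
HM-EQUALITY Δ2).  The derivation of record (R8 §E, Steps 1–5; tree files
`Literature/RepresentationTheory/Liu2021/AlbaneseBlockMultiplicityOne.lean`, `…/AlbanesePullbackFixedVectors.lean`)
needs, between STEP 2 («a `K`-fixed vector of the image of the pull-back map is the image of a `K`-fixed element of
`Ω(μ) ⊗_{M_μ} ℂ`») and STEP 3 ([Liu2021] Thm. 4.18 (1), l. 2239: «`Ω(μ)^K ≃ Hom_E(A_K, A_μ)_ℚ` for every sufficiently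
small open compact subgroup `K`»), the identity

  `(Ω(μ) ⊗_{M_μ} ℂ)^K = Ω(μ)^K ⊗_{M_μ} ℂ`

(«`𝔾(𝔸_F^∞)` acts `M_μ`-linearly» on `Ω(μ)`, Def. 4.16, l. 2219).  `AlbanesePullbackFixedVectors.lean` proves it in
COORDINATES (a `k`-basis with `M`-rational operator matrices).  THIS FILE proves it in the TENSOR FORM in which the
as-printed record `Liu2021.Thm418AsPrinted` (p277833) is typed — Mathlib's `ℂ ⊗[M_μ] Ω(μ)` with `g ↦ (rhoΩ g).baseChange ℂ`
— and transports it through the printed isomorphism `Φ : Ω(μ) ⊗_{M_μ} ℂ ≃ ⊕_{ε,χ} ω(μ,ε,χ)` «of `ℂ[𝔾(𝔸_F^∞)]`-modules»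
(Thm. 4.18, l. 2233–2237), so that with item (1) (l. 2239) one gets, for `K` small:

  every componentwise `K`-fixed `y ∈ ⊕_{ε,χ} ω(μ,ε,χ)` is a `ℂ`-combination of the vectors `Φ(f ⊗ 1)`,
  `f ∈ Hom_E(A_K, A_μ)_ℚ` (through the canonical map `res` of item (1)), and conversely these are `K`-fixed

(`Thm418Data.setOf_directSum_fixed_eq_span`, `Thm418Data.exists_intertwining_fixed_mem_span`; in `ℂ[G]`-module currency on
Mathlib's `(Representation.directSum (fun i ↦ D.rhoAt i)).asModule`: `Thm418Data.asModule_mem_span_of_smul_eq`).  This is exactly the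
hypothesis `hgen` of `Literature.RepresentationTheory.Liu2021.mapReading_of_source_invariants` with
`Gen K := Set.range (fun f ↦ Φ (1 ⊗ₜ res K D_μ f))`, now DERIVED from the as-printed record; the bridge's remaining
inputs are Step 1 (multiplicity one / Prop. 4.13) and `hcm` (the map (4.3) of the proof of Thm. 4.18, Lem. 2.4 (1), the
object pin) — not touched here.

## Mathematics (no averaging, no smoothness)

§1 consists of PRIVATE adapters of the TREE lemma `Literature.LinearAlgebra.BaseChange.mem_span_tmul_fixed_of_baseChange_fixed`
(`Literature/LinearAlgebra/BaseChange/FixedPointsBaseChange.lean`; Milne, *Algebraic Groups*, Cor. 4.34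
«`(V ⊗ k')^{G_{k'}} ≃ V^G ⊗ k'`» — imported, not restated): for a field `R`, any commutative `R`-algebra `A` and ANY
family of `R`-linear endomorphisms `f a` of an `R`-module `N`, an element of `A ⊗_R N` fixed by every `1 ⊗ f a` lies in
the `A`-span of `1 ⊗ N^{f}` (`N^{f}` = the common fixed vectors; the tree lemma expands along an `R`-basis of `A`, every
coordinate being fixed).  The index family is arbitrary (no finiteness of `K`, no compactness, no averaging, no
characteristic hypothesis); the converse inclusion is trivial.  §2 instantiates at `D : Thm418Data F E`
(`R = M_μ = fieldOfValues E D.μ`, `A = ℂ`, `N = Ω(μ)`, `f k = rhoΩ k`, `k ∈ K`) and pushes through `Φ` using only its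
printed intertwining clause.

Theorems only: no `def`, no instance, no named fact, nothing asserted about Liu's objects (every statement is about an
arbitrary datum `D`, resp. assumes `Thm418AsPrinted D` / its item (1) for that datum).  Seat
prover-pub-hodgecm2-tr-prover-6-g3-0 (item-(vi) END-display lineage), 2026-08-21.

## References
* [Liu2021] Def. 4.16 (l. 2218–2224: `Ω(μ)`, «`𝔾(𝔸_F^∞)` acts `M_μ`-linearly»), Rem. 4.17 (l. 2226–2228),
  Thm. 4.18 main statement (l. 2233–2237) and item (1) (l. 2239).
* J. S. Milne, *Algebraic Groups*, CUP (2017), Prop. 4.31 / Cor. 4.34 — via the tree file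
  `Literature/LinearAlgebra/BaseChange/FixedPointsBaseChange.lean` (imported). [Milne2017]
* Tree: `Liu2021.Thm418AsPrinted` (this directory); `Literature.RepresentationTheory.Liu2021.mem_span_fixed_rational_of_fixed`,
  `…mapReading_of_source_invariants` (`RepresentationTheory/Liu2021/AlbanesePullbackFixedVectors.lean`).
-/

noncomputable section

open NumberField TensorProduct DirectSum

namespace Literature.NumberTheory.Automorphic.Liu2021

/-! ## §1  Fixed vectors of `A ⊗_R N` under `1 ⊗ f` descend to `N` (base change commutes with invariants) -/

section Generic

variable {R : Type*} [Field R] {A : Type*} [CommRing A] [Algebra R A]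
  {N : Type*} [AddCommGroup N] [Module R N]

/-- **Base change commutes with invariants, `⊆`** — adapter of the TREE lemma
`Literature.LinearAlgebra.BaseChange.mem_span_tmul_fixed_of_baseChange_fixed` (Milne, *Algebraic Groups*, Cor. 4.34
«`(V ⊗ k')^{G_{k'}} ≃ V^G ⊗ k'`», the coordinate argument along a basis of the free extension; in tree since
`Literature/LinearAlgebra/BaseChange/FixedPointsBaseChange.lean`) to the `A`-span of the pure tensors `1 ⊗ n`: if
`x ∈ A ⊗_R N` satisfies `(1 ⊗ f a) x = x` for every member of ANY family `f a : N →ₗ[R] N`, then `x` lies in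
`span_A {1 ⊗ n | ∀ a, f a n = n}` (the tree lemma gives the `R`-span of all `a ⊗ n` with `n` fixed; `a ⊗ n = a • (1 ⊗ n)`).
No finiteness, averaging or smoothness is used.  (Private helper.) [folklore] -/
private theorem mem_span_tmul_fixed_of_forall_baseChange_eq {ι : Sort*} (f : ι → (N →ₗ[R] N)) {x : A ⊗[R] N}
    (hx : ∀ a, (f a).baseChange A x = x) :
    x ∈ Submodule.span A ((fun n : N => (1 : A) ⊗ₜ[R] n) '' {n : N | ∀ a, f a n = n}) := by
  have h := Literature.LinearAlgebra.BaseChange.mem_span_tmul_fixed_of_baseChange_fixed (A := A) f hx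
  refine (Submodule.span_le.mpr ?_ :
    Submodule.span R {z : A ⊗[R] N | ∃ (a : A) (n : N), (∀ i, f i n = n) ∧ z = a ⊗ₜ[R] n} ≤
      (Submodule.span A ((fun n : N => (1 : A) ⊗ₜ[R] n) '' {n : N | ∀ a, f a n = n})).restrictScalars R) h
  rintro _ ⟨a, n, hn, rfl⟩
  have hsmul : a ⊗ₜ[R] n = a • ((1 : A) ⊗ₜ[R] n) := by
    rw [TensorProduct.smul_tmul', smul_eq_mul, mul_one]
  rw [Submodule.coe_restrictScalars, SetLike.mem_coe, hsmul]
  exact Submodule.smul_mem _ _ (Submodule.subset_span ⟨n, hn, rfl⟩)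

/-- **Base change commutes with invariants, `⊇`** (the trivial inclusion): every element of the `A`-span of the
`1 ⊗ n`, `n` fixed by all `f a`, is fixed by all `1 ⊗ f a`. [folklore] -/
private theorem forall_baseChange_eq_of_mem_span_tmul_fixed {ι : Sort*} (f : ι → (N →ₗ[R] N)) {x : A ⊗[R] N}
    (hx : x ∈ Submodule.span A ((fun n : N => (1 : A) ⊗ₜ[R] n) '' {n : N | ∀ a, f a n = n})) (a : ι) :
    (f a).baseChange A x = x := by
  induction hx using Submodule.span_induction with
  | mem y hy =>
    obtain ⟨n, hn, rfl⟩ := hy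
    rw [LinearMap.baseChange_tmul, hn a]
  | zero => rw [map_zero]
  | add y z _ _ hy hz => rw [map_add, hy, hz]
  | smul c y _ hy => rw [map_smul, hy]

end Generic

/-! ## §2  At the datum of [Liu2021, Thm. 4.18]: `(Ω(μ) ⊗_{M_μ} ℂ)^K = Ω(μ)^K ⊗_{M_μ} ℂ`, and through `Φ` -/

namespace Thm418Data

variable {F E : Type} [Field F] [NumberField F] [IsTotallyReal F] [Field E] [NumberField E] [Algebra F E]
  [IsTotallyComplex E] [Algebra.IsQuadraticExtension F E] {D : Thm418Data F E}

/-- **`(Ω(μ) ⊗_{M_μ} ℂ)^K ⊆ Ω(μ)^K ⊗_{M_μ} ℂ`.**  For ANY subgroup `K ≤ 𝔾(𝔸_F^∞)`: an element of `Ω(μ) ⊗_{M_μ} ℂ`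
(Mathlib's `ℂ ⊗[M_μ] Ω(μ)`) fixed by every `g ⊗ 1 = (rhoΩ g).baseChange ℂ`, `g ∈ K`, is a `ℂ`-combination of pure
tensors `1 ⊗ ω` with `ω ∈ Ω(μ)^K` (`D.invariants K`).  Input from print: «`𝔾(𝔸_F^∞)` acts `M_μ`-linearly» on `Ω(μ)`
([Liu2021] Def. 4.16, l. 2219), which is how `rhoΩ` is typed; the rest is §1. [cite: Liu2021, Def. 4.16 (l. 2219)] -/
theorem mem_span_tmul_invariants_of_fixed (K : Subgroup D.G) {x : ℂ ⊗[fieldOfValues E D.μ] D.Ω}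
    (hx : ∀ k ∈ K, (D.rhoΩ k).baseChange ℂ x = x) :
    x ∈ Submodule.span ℂ ((fun ω : D.Ω => (1 : ℂ) ⊗ₜ[fieldOfValues E D.μ] ω) '' D.invariants K) := by
  have h := mem_span_tmul_fixed_of_forall_baseChange_eq (A := ℂ) (fun k : K => D.rhoΩ (k : D.G))
    (fun k => hx k k.2) (x := x)
  have hset : {n : D.Ω | ∀ a : K, D.rhoΩ (a : D.G) n = n} = D.invariants K :=
    Set.ext fun n => ⟨fun hn k hk => hn ⟨k, hk⟩, fun hn a => hn a a.2⟩
  rwa [hset] at h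

/-- **`Ω(μ)^K ⊗_{M_μ} ℂ ⊆ (Ω(μ) ⊗_{M_μ} ℂ)^K`** (trivial direction). [cite: Liu2021, Def. 4.16 (l. 2219)] -/
theorem fixed_of_mem_span_tmul_invariants (K : Subgroup D.G) {x : ℂ ⊗[fieldOfValues E D.μ] D.Ω}
    (hx : x ∈ Submodule.span ℂ ((fun ω : D.Ω => (1 : ℂ) ⊗ₜ[fieldOfValues E D.μ] ω) '' D.invariants K)) :
    ∀ k ∈ K, (D.rhoΩ k).baseChange ℂ x = x := by
  intro k hk
  have hset : {n : D.Ω | ∀ a : K, D.rhoΩ (a : D.G) n = n} = D.invariants K :=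
    Set.ext fun n => ⟨fun hn k hk => hn ⟨k, hk⟩, fun hn a => hn a a.2⟩
  rw [← hset] at hx
  exact forall_baseChange_eq_of_mem_span_tmul_fixed (A := ℂ) (fun k : K => D.rhoΩ (k : D.G)) hx ⟨k, hk⟩

/-- **`(Ω(μ) ⊗_{M_μ} ℂ)^K = Ω(μ)^K ⊗_{M_μ} ℂ`** as an equality of subsets of `ℂ ⊗[M_μ] Ω(μ)`, for every subgroup `K`
(STEP 2, second half, of the combined reading, in tensor form). [cite: Liu2021, Def. 4.16 (l. 2219)] -/
theorem setOf_fixed_eq_span_tmul_invariants (K : Subgroup D.G) :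
    {x : ℂ ⊗[fieldOfValues E D.μ] D.Ω | ∀ k ∈ K, (D.rhoΩ k).baseChange ℂ x = x} =
      ↑(Submodule.span ℂ ((fun ω : D.Ω => (1 : ℂ) ⊗ₜ[fieldOfValues E D.μ] ω) '' D.invariants K)) :=
  Set.ext fun _ => ⟨fun hx => mem_span_tmul_invariants_of_fixed K hx, fun hx => fixed_of_mem_span_tmul_invariants K hx⟩

/-- **With item (1): `(Ω(μ) ⊗_{M_μ} ℂ)^K` is spanned by the `f ⊗ 1`, `f ∈ Hom_E(A_K, A_μ)_ℚ`.**  If at the level `K` the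
canonical map `res K D_μ : Hom_E(A_K, A_μ)_ℚ → Ω(μ)` has image `Ω(μ)^K` ([Liu2021] Thm. 4.18 (1), l. 2239, for `K`
sufficiently small — the hypothesis `hrange` is that conjunct of `Liu2021.Thm418AsPrinted` at `K`), then every `K`-fixed
element of `Ω(μ) ⊗_{M_μ} ℂ` is a `ℂ`-combination of the `1 ⊗ res K D_μ f`. [cite: Liu2021, Thm. 4.18 (1) (l. 2239)] -/
theorem mem_span_tmul_res_of_fixed (K : Subgroup D.G) (Dμ : D.Obj)
    (hrange : Set.range (D.res K Dμ) = D.invariants K) {x : ℂ ⊗[fieldOfValues E D.μ] D.Ω}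
    (hx : ∀ k ∈ K, (D.rhoΩ k).baseChange ℂ x = x) :
    x ∈ Submodule.span ℂ (Set.range fun f : D.HomK K Dμ => (1 : ℂ) ⊗ₜ[fieldOfValues E D.μ] (D.res K Dμ f)) := by
  have h := mem_span_tmul_invariants_of_fixed K hx
  rwa [← hrange, ← Set.range_comp] at h

/-- The generators are fixed: `1 ⊗ res K D_μ f` is fixed by every `g ⊗ 1`, `g ∈ K`, as soon as the image of `res K D_μ`
lies in `Ω(μ)^K` (item (1) gives equality). [cite: Liu2021, Thm. 4.18 (1) (l. 2239)] -/
theorem baseChange_tmul_res_eq (K : Subgroup D.G) (Dμ : D.Obj) (hrange : Set.range (D.res K Dμ) = D.invariants K)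
    (f : D.HomK K Dμ) {k : D.G} (hk : k ∈ K) :
    (D.rhoΩ k).baseChange ℂ ((1 : ℂ) ⊗ₜ[fieldOfValues E D.μ] D.res K Dμ f) =
      (1 : ℂ) ⊗ₜ[fieldOfValues E D.μ] D.res K Dμ f := by
  have hmem : D.res K Dμ f ∈ D.invariants K := hrange ▸ Set.mem_range_self f
  rw [LinearMap.baseChange_tmul, hmem k hk]

section ThroughPhi

variable (Φ : (ℂ ⊗[fieldOfValues E D.μ] D.Ω) ≃ₗ[ℂ] (⨁ i : D.AdmIndex, D.omegaAt i))

/-- **Transport through the printed isomorphism: `K`-fixedness.**  If `Φ : Ω(μ) ⊗_{M_μ} ℂ ≃ ⊕_{ε,χ} ω(μ,ε,χ)`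
intertwines `g ⊗ 1` with the componentwise action of `g` (the clause «isomorphism … of `ℂ[𝔾(𝔸_F^∞)]`-modules» of
[Liu2021] Thm. 4.18, l. 2233–2237, as typed in `Liu2021.Thm418AsPrinted`), then `y` is componentwise `K`-fixed iff
`Φ⁻¹ y` is `K`-fixed. [cite: Liu2021, Thm. 4.18 (l. 2233–2237)] -/
theorem forall_rhoAt_eq_iff_fixed_symm
    (hΦ : ∀ (g : D.G) (x : ℂ ⊗[fieldOfValues E D.μ] D.Ω) (i : D.AdmIndex),
      Φ ((D.rhoΩ g).baseChange ℂ x) i = D.rhoAt i g (Φ x i))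
    (K : Subgroup D.G) (y : ⨁ i : D.AdmIndex, D.omegaAt i) :
    (∀ k ∈ K, ∀ i, D.rhoAt i k (y i) = y i) ↔ ∀ k ∈ K, (D.rhoΩ k).baseChange ℂ (Φ.symm y) = Φ.symm y := by
  constructor
  · intro hy k hk
    apply Φ.injective
    refine DFinsupp.ext fun i => ?_
    rw [hΦ k (Φ.symm y) i, Φ.apply_symm_apply, hy k hk i]
  · intro hx k hk i
    have h := congrArg (fun z => Φ z i) (hx k hk)
    simp only [hΦ k (Φ.symm y) i, Φ.apply_symm_apply] at h
    exact h

/-- **STEPS 2–3 on the as-printed record, through `Φ`.**  Let `Φ` intertwine as printed (Thm. 4.18, l. 2233–2237) and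
let `K`, `D_μ` be such that the canonical map `res K D_μ` has image `Ω(μ)^K` (item (1), l. 2239, `K` small).  Then
every componentwise `K`-fixed `y ∈ ⊕_{ε,χ} ω(μ,ε,χ)` is a `ℂ`-linear combination of the vectors `Φ (1 ⊗ res K D_μ f)`,
`f ∈ Hom_E(A_K, A_μ)_ℚ`: `Φ⁻¹ y` is `K`-fixed (`forall_rhoAt_eq_iff_fixed_symm`), hence in `Ω(μ)^K ⊗_{M_μ} ℂ`
(`mem_span_tmul_res_of_fixed`), and `Φ` maps that span onto the stated one.  This is the hypothesis `hgen` of the tree's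
`Literature.RepresentationTheory.Liu2021.mapReading_of_source_invariants` with `Gen K := Set.range (Φ (1 ⊗ₜ res K D_μ ·))`.
[cite: Liu2021, Thm. 4.18 with (1) (l. 2233–2239); Def. 4.16 (l. 2219)] -/
theorem directSum_mem_span_of_fixed
    (hΦ : ∀ (g : D.G) (x : ℂ ⊗[fieldOfValues E D.μ] D.Ω) (i : D.AdmIndex),
      Φ ((D.rhoΩ g).baseChange ℂ x) i = D.rhoAt i g (Φ x i))
    (K : Subgroup D.G) (Dμ : D.Obj) (hrange : Set.range (D.res K Dμ) = D.invariants K)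
    {y : ⨁ i : D.AdmIndex, D.omegaAt i} (hy : ∀ k ∈ K, ∀ i, D.rhoAt i k (y i) = y i) :
    y ∈ Submodule.span ℂ
      (Set.range fun f : D.HomK K Dμ => Φ ((1 : ℂ) ⊗ₜ[fieldOfValues E D.μ] D.res K Dμ f)) := by
  have hx : ∀ k ∈ K, (D.rhoΩ k).baseChange ℂ (Φ.symm y) = Φ.symm y :=
    (forall_rhoAt_eq_iff_fixed_symm Φ hΦ K y).mp hy
  have hmem := mem_span_tmul_res_of_fixed K Dμ hrange hx
  have hmap : Φ (Φ.symm y) ∈ Submodule.map (Φ : (ℂ ⊗[fieldOfValues E D.μ] D.Ω) →ₗ[ℂ] (⨁ i : D.AdmIndex, D.omegaAt i))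
      (Submodule.span ℂ (Set.range fun f : D.HomK K Dμ => (1 : ℂ) ⊗ₜ[fieldOfValues E D.μ] (D.res K Dμ f))) :=
    Submodule.mem_map_of_mem hmem
  rw [Φ.apply_symm_apply, Submodule.map_span, ← Set.range_comp] at hmap
  exact hmap

/-- The generators `Φ (1 ⊗ res K D_μ f)` are componentwise `K`-fixed (item (1): the image of `res K D_μ` is `Ω(μ)^K`).
[cite: Liu2021, Thm. 4.18 with (1) (l. 2233–2239)] -/
theorem rhoAt_apply_tmul_res_eq
    (hΦ : ∀ (g : D.G) (x : ℂ ⊗[fieldOfValues E D.μ] D.Ω) (i : D.AdmIndex),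
      Φ ((D.rhoΩ g).baseChange ℂ x) i = D.rhoAt i g (Φ x i))
    (K : Subgroup D.G) (Dμ : D.Obj) (hrange : Set.range (D.res K Dμ) = D.invariants K) (f : D.HomK K Dμ)
    {k : D.G} (hk : k ∈ K) (i : D.AdmIndex) :
    D.rhoAt i k (Φ ((1 : ℂ) ⊗ₜ[fieldOfValues E D.μ] D.res K Dμ f) i) =
      Φ ((1 : ℂ) ⊗ₜ[fieldOfValues E D.μ] D.res K Dμ f) i := by
  rw [← hΦ k _ i, baseChange_tmul_res_eq K Dμ hrange f hk]

/-- **`(⊕_{ε,χ} ω(μ,ε,χ))^K = Φ(Ω(μ)^K ⊗_{M_μ} ℂ) = span {Φ (f ⊗ 1) : f ∈ Hom_E(A_K, A_μ)_ℚ}`**, as an equality of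
subsets of the direct sum, for every `K`, `D_μ` at which item (1) holds (`hrange`) — the tensor-form content of
«`Ω(μ)^K ≃ Hom_E(A_K, A_μ)_ℚ`» read on the right-hand side of the printed isomorphism.
[cite: Liu2021, Thm. 4.18 with (1) (l. 2233–2239); Def. 4.16 (l. 2219)] -/
theorem setOf_directSum_fixed_eq_span
    (hΦ : ∀ (g : D.G) (x : ℂ ⊗[fieldOfValues E D.μ] D.Ω) (i : D.AdmIndex),
      Φ ((D.rhoΩ g).baseChange ℂ x) i = D.rhoAt i g (Φ x i))
    (K : Subgroup D.G) (Dμ : D.Obj) (hrange : Set.range (D.res K Dμ) = D.invariants K) :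
    {y : ⨁ i : D.AdmIndex, D.omegaAt i | ∀ k ∈ K, ∀ i, D.rhoAt i k (y i) = y i} =
      ↑(Submodule.span ℂ (Set.range fun f : D.HomK K Dμ => Φ ((1 : ℂ) ⊗ₜ[fieldOfValues E D.μ] D.res K Dμ f))) := by
  refine Set.ext fun y => ⟨fun hy => directSum_mem_span_of_fixed Φ hΦ K Dμ hrange hy, fun hy => ?_⟩
  intro k hk i
  induction hy using Submodule.span_induction with
  | mem z hz =>
    obtain ⟨f, rfl⟩ := hz
    exact rhoAt_apply_tmul_res_eq Φ hΦ K Dμ hrange f hk i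
  | zero => simp only [DirectSum.zero_apply, map_zero]
  | add z w _ _ hz hw => simp only [DirectSum.add_apply, map_add, hz, hw]
  | smul c z _ hz => simp only [DirectSum.smul_apply, map_smul, hz]

/-- Componentwise `K`-fixedness of `y ∈ ⊕_{ε,χ} ω(μ,ε,χ)` is `K`-fixedness under Mathlib's direct-sum representation
`Representation.directSum (fun i ↦ D.rhoAt i)` (the «componentwise action of `g`» in the typing of Thm. 4.18's
«isomorphism of `ℂ[𝔾(𝔸_F^∞)]`-modules»). Bookkeeping. [cite: Liu2021, Thm. 4.18 (l. 2233–2237)] -/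
theorem forall_directSum_apply_eq_iff (K : Subgroup D.G) (y : ⨁ i : D.AdmIndex, D.omegaAt i) :
    (∀ k ∈ K, Representation.directSum (fun i => D.rhoAt i) k y = y) ↔ ∀ k ∈ K, ∀ i, D.rhoAt i k (y i) = y i := by
  refine forall₂_congr fun k _ => ?_
  rw [Representation.directSum_apply]
  constructor
  · intro h i
    have h' := DFunLike.congr_fun h i
    erw [DirectSum.lmap_apply] at h'
    exact h'
  · intro h
    refine DFinsupp.ext fun i => ?_
    erw [DirectSum.lmap_apply]
    exact h i

/-- `setOf_directSum_fixed_eq_span` with fixedness under `Representation.directSum (fun i ↦ D.rhoAt i)`: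
`(⊕ ω(μ,ε,χ))^K = span {Φ (1 ⊗ res K D_μ f)}` for every `K`, `D_μ` at which item (1) holds.
[cite: Liu2021, Thm. 4.18 with (1) (l. 2233–2239); Def. 4.16 (l. 2219)] -/
theorem setOf_directSum_rep_fixed_eq_span
    (hΦ : ∀ (g : D.G) (x : ℂ ⊗[fieldOfValues E D.μ] D.Ω) (i : D.AdmIndex),
      Φ ((D.rhoΩ g).baseChange ℂ x) i = D.rhoAt i g (Φ x i))
    (K : Subgroup D.G) (Dμ : D.Obj) (hrange : Set.range (D.res K Dμ) = D.invariants K) :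
    {y : ⨁ i : D.AdmIndex, D.omegaAt i | ∀ k ∈ K, Representation.directSum (fun i => D.rhoAt i) k y = y} =
      ↑(Submodule.span ℂ (Set.range fun f : D.HomK K Dμ => Φ ((1 : ℂ) ⊗ₜ[fieldOfValues E D.μ] D.res K Dμ f))) := by
  rw [← setOf_directSum_fixed_eq_span Φ hΦ K Dμ hrange]
  exact Set.ext fun y => forall_directSum_apply_eq_iff K y

end ThroughPhi

section AsModule

variable (Φ : (ℂ ⊗[fieldOfValues E D.μ] D.Ω) ≃ₗ[ℂ] (⨁ i : D.AdmIndex, D.omegaAt i))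

/-- **`ℂ[𝔾(𝔸_F^∞)]`-module currency.**  On Mathlib's `ℂ[G]`-module `(Representation.directSum (fun i ↦ D.rhoAt i)).asModule`
(the direct sum `⊕_{ε,χ} ω(μ,ε,χ)` with `ℂ[G]` acting through the componentwise representation), `y` is fixed by the group
elements `[k] = MonoidAlgebra.of ℂ G k`, `k ∈ K`, iff it is componentwise `K`-fixed.  Bookkeeping for consumers phrased over
`R = ℂ[G]`-modules (the tree's `mapReading_of_source_invariants`). [cite: Liu2021, Thm. 4.18 (l. 2233–2237)] -/
theorem asModule_forall_of_smul_eq_iff (K : Subgroup D.G) (y : (Representation.directSum (fun i => D.rhoAt i)).asModule) :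
    (∀ k ∈ K, MonoidAlgebra.of ℂ D.G k • y = y) ↔
      ∀ k ∈ K, ∀ i, D.rhoAt i k ((Representation.directSum (fun i => D.rhoAt i)).asModuleEquiv y i) =
        (Representation.directSum (fun i => D.rhoAt i)).asModuleEquiv y i := by
  rw [← forall_directSum_apply_eq_iff K]
  refine forall₂_congr fun k _ => ?_
  rw [MonoidAlgebra.of_apply, Representation.single_smul, one_smul]
  exact Iff.rfl

/-- **STEPS 2–3 in `ℂ[G]`-module currency.**  With `Φ` intertwining as printed and item (1) at `(K, D_μ)` (`hrange`): a
vector `y` of the `ℂ[G]`-module `(Representation.directSum (fun i ↦ D.rhoAt i)).asModule` fixed by all `[k]`, `k ∈ K`, lies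
— read in `⊕_{ε,χ} ω(μ,ε,χ)` — in the `ℂ`-span of the `Φ (1 ⊗ res K D_μ f)`, `f ∈ Hom_E(A_K, A_μ)_ℚ`.
[cite: Liu2021, Thm. 4.18 with (1) (l. 2233–2239); Def. 4.16 (l. 2219)] -/
theorem asModuleEquiv_mem_span_of_smul_eq
    (hΦ : ∀ (g : D.G) (x : ℂ ⊗[fieldOfValues E D.μ] D.Ω) (i : D.AdmIndex),
      Φ ((D.rhoΩ g).baseChange ℂ x) i = D.rhoAt i g (Φ x i))
    (K : Subgroup D.G) (Dμ : D.Obj) (hrange : Set.range (D.res K Dμ) = D.invariants K)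
    {y : (Representation.directSum (fun i => D.rhoAt i)).asModule}
    (hy : ∀ k ∈ K, MonoidAlgebra.of ℂ D.G k • y = y) :
    (Representation.directSum (fun i => D.rhoAt i)).asModuleEquiv y ∈ Submodule.span ℂ
      (Set.range fun f : D.HomK K Dμ => Φ ((1 : ℂ) ⊗ₜ[fieldOfValues E D.μ] D.res K Dμ f)) :=
  directSum_mem_span_of_fixed Φ hΦ K Dμ hrange ((asModule_forall_of_smul_eq_iff K y).mp hy)

/-- The same membership stated INSIDE the `ℂ[G]`-module `(Representation.directSum (fun i ↦ D.rhoAt i)).asModule` (generators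
transported by `asModuleEquiv.symm`, the identity): the hypothesis `hgen` of the tree's
`Literature.RepresentationTheory.Liu2021.mapReading_of_source_invariants` for the operator sets `S K = {[k] : k ∈ K}` and
`Gen K := Set.range (asModuleEquiv.symm ∘ Φ ∘ (1 ⊗ₜ res K D_μ ·))`, at every `(K, D_μ)` where item (1) holds.
[cite: Liu2021, Thm. 4.18 with (1) (l. 2233–2239); Def. 4.16 (l. 2219)] -/
theorem asModule_mem_span_of_smul_eq
    (hΦ : ∀ (g : D.G) (x : ℂ ⊗[fieldOfValues E D.μ] D.Ω) (i : D.AdmIndex),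
      Φ ((D.rhoΩ g).baseChange ℂ x) i = D.rhoAt i g (Φ x i))
    (K : Subgroup D.G) (Dμ : D.Obj) (hrange : Set.range (D.res K Dμ) = D.invariants K)
    {y : (Representation.directSum (fun i => D.rhoAt i)).asModule}
    (hy : ∀ k ∈ K, MonoidAlgebra.of ℂ D.G k • y = y) :
    y ∈ Submodule.span ℂ (Set.range fun f : D.HomK K Dμ =>
      (Representation.directSum (fun i => D.rhoAt i)).asModuleEquiv.symm
        (Φ ((1 : ℂ) ⊗ₜ[fieldOfValues E D.μ] D.res K Dμ f))) := by
  have h := Submodule.mem_map_of_mem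
    (f := ((Representation.directSum (fun i => D.rhoAt i)).asModuleEquiv.symm :
      (⨁ i : D.AdmIndex, D.omegaAt i) →ₗ[ℂ] (Representation.directSum (fun i => D.rhoAt i)).asModule))
    (asModuleEquiv_mem_span_of_smul_eq Φ hΦ K Dμ hrange hy)
  rw [Submodule.map_span, ← Set.range_comp] at h
  simpa only [LinearEquiv.coe_coe, LinearEquiv.symm_apply_apply, Function.comp_def] using h

end AsModule

/-- **[Liu2021] Thm. 4.18 AS PRINTED ⟹ the fixed-vector reading (STEPS 2–3 of the combined reading), packaged.**  From
`Thm418AsPrinted D`: the printed isomorphism `Φ` (with its intertwining clause) and, for every object `D_μ ∈ 𝒜(μ)`, a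
threshold `K₀` (open compact) such that for every open compact `K ≤ K₀` the canonical map `res K D_μ` is injective and
every componentwise `K`-fixed vector of `⊕_{ε,χ} ω(μ,ε,χ)` is a `ℂ`-combination of the `Φ (1 ⊗ res K D_μ f)`,
`f ∈ Hom_E(A_K, A_μ)_ℚ`.  CAUTION for consumers who also destructure `Thm418AsPrinted D` themselves: the `Φ` produced here
is the SAME printed isomorphism only if you use this package's `Φ` throughout (existential elimination twice gives
unrelated witnesses); otherwise use `directSum_mem_span_of_fixed` with your own `Φ`. [cite: Liu2021, Thm. 4.18 with (1) (l. 2232–2239)] -/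
theorem exists_intertwining_fixed_mem_span (h : Liu2021.Thm418AsPrinted D) :
    ∃ Φ : (ℂ ⊗[fieldOfValues E D.μ] D.Ω) ≃ₗ[ℂ] (⨁ i : D.AdmIndex, D.omegaAt i),
      (∀ (g : D.G) (x : ℂ ⊗[fieldOfValues E D.μ] D.Ω) (i : D.AdmIndex),
          Φ ((D.rhoΩ g).baseChange ℂ x) i = D.rhoAt i g (Φ x i)) ∧
      ∀ Dμ : D.Obj, ∃ K₀ : Subgroup D.G, IsOpenCompact K₀ ∧
        ∀ K : Subgroup D.G, IsOpenCompact K → K ≤ K₀ →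
          Function.Injective (D.res K Dμ) ∧
          ∀ y : ⨁ i : D.AdmIndex, D.omegaAt i, (∀ k ∈ K, ∀ i, D.rhoAt i k (y i) = y i) →
            y ∈ Submodule.span ℂ
              (Set.range fun f : D.HomK K Dμ => Φ ((1 : ℂ) ⊗ₜ[fieldOfValues E D.μ] D.res K Dμ f)) := by
  obtain ⟨Φ, hΦ, h1, -, -⟩ := h
  refine ⟨Φ, hΦ, fun Dμ => ?_⟩
  obtain ⟨K₀, hK₀, hK⟩ := h1 Dμ
  refine ⟨K₀, hK₀, fun K hKo hle => ⟨(hK K hKo hle).1, fun y hy => ?_⟩⟩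
  exact directSum_mem_span_of_fixed Φ hΦ K Dμ (hK K hKo hle).2 hy

/-- **The `Ω(μ)`-side package**: from `Thm418AsPrinted D`, for every `D_μ` and every sufficiently small open compact
`K`, every `K`-fixed element of `Ω(μ) ⊗_{M_μ} ℂ` is a `ℂ`-combination of the `1 ⊗ res K D_μ f` — «a `K`-fixed element
of `Ω(μ) ⊗_{M_μ} ℂ` is `Σ z_i (f_i ⊗ 1)` with honest homomorphisms `f_i ∈ Hom_E(A_K, A_μ)_ℚ`» (STEP 3 of the derivation
of record). [cite: Liu2021, Thm. 4.18 (1) (l. 2239); Def. 4.16 (l. 2219)] -/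
theorem exists_level_fixed_mem_span_tmul_res (h : Liu2021.Thm418AsPrinted D) (Dμ : D.Obj) :
    ∃ K₀ : Subgroup D.G, IsOpenCompact K₀ ∧
      ∀ K : Subgroup D.G, IsOpenCompact K → K ≤ K₀ →
        ∀ x : ℂ ⊗[fieldOfValues E D.μ] D.Ω, (∀ k ∈ K, (D.rhoΩ k).baseChange ℂ x = x) →
          x ∈ Submodule.span ℂ (Set.range fun f : D.HomK K Dμ => (1 : ℂ) ⊗ₜ[fieldOfValues E D.μ] (D.res K Dμ f)) := by
  obtain ⟨-, -, h1, -, -⟩ := h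
  obtain ⟨K₀, hK₀, hK⟩ := h1 Dμ
  exact ⟨K₀, hK₀, fun K hKo hle x hx => mem_span_tmul_res_of_fixed K Dμ (hK K hKo hle).2 hx⟩

end Thm418Data

end Literature.NumberTheory.Automorphic.Liu2021

end
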